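import Summits.HubbardSuperconductivity.HubbardSuperconductivity.Theorems.WidthHaldaneTubeTwistedPlaneWaves

/-!
# Plane waves of the labelled two-leg LADDER `ℤ/L × ℤ/2` and the free (`U = 0`) floor of its
# twisted sector energies `tubeEnergy L 2 Λ e 0 θ`

The width `M = 2` member of the cruxes' tube family (16311/16312/18509/18510) is the isotropic
Hubbard ladder — the width every numerical and bosonisation study treats first — but it is NOT covered
by `WidthHaldaneTubePlaneWaves` / `WidthHaldaneTubeTwistedPlaneWaves` (`L, M ≥ 3`): in `ℤ/2` the two
transverse steps `±e₂` coincide, the rung `(a,0) – (a,1)` of `tubeGraph` is a single bond, and the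
free band is `ε^θ_{L,2}(a,b) = -2cos((2πa-θ)/L) - (-1)^b` (`ladderTwistedBand`, `WidthHaldaneDefs`)
instead of `-2cos((2πa-θ)/L) - 2cos(2πb/2)`. This file redoes the diagonalisation at `M = 2`,
sorry-free, reusing the twisted mode matrix and its orthonormality from the rectangular file:

* `sub_e2_eq_add_e2`, `stdAddChar_zmod_two`, `ladderTwistedBand_eq` — `ℤ/2` bookkeeping
  (`ε^θ_{L,2} = tubeTwistedBand L 2 θ + (-1)^b`);
* `sum_adj_tubeGraph_two` — the neighbour sum of the ladder has THREE terms (`L ≥ 3`);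
* `ladder_twistedWave_stencil`, `twistedOneBody_mul_twistedPlaneWaves_ladder` — the twisted plane
  waves diagonalise `h + T_θ` with spectrum `ladderTwistedBand L θ ∘ e`;
* **`tubeEnergy_free_ladder_eq`** — `tubeEnergy L 2 Λ e 0 θ (2 #F) = 2 Σ_{k∈F} ε^θ_{L,2}(k)` for every
  Fermi set `F` of the twisted ladder band; variational / existence forms `tubeEnergy_free_ladder_le`,
  `exists_fermiSet_tubeEnergy_free_ladder_eq`, and the same-Fermi-set comparison
  `tubeEnergy_free_ladder_sub_le` (`E(θ) - E(0) ≤ 2Σ_F (ε^θ - ε^0)` for a Fermi set of the untwisted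
  band) — the free paramagnetic/diamagnetic test deciding the sign of `tubeStiffness L 2 … 0 δ`
  (consumer: `PerWidthThermodynamics/Negative/ZeroCouplingStiffness`).

Sources: N. Byers, C. N. Yang, PRL 7 (1961) 46; R. M. Noack, S. R. White, D. J. Scalapino,
Physica C 270 (1996) 281 §2 (ladder bands); BCS (1957) §II. Folklore; no definitions, no named facts.
REUSED: `twistedWave_stencil`, `conjTranspose_twistedPlaneWaves_mul_self`, `sum_seam_A/B`,
`tubeGraph_adj_iff`, `tubeH0_zero_eq_dGamma`, `tubeTwist_eq_dGamma`,
`minEnergyOn_dGamma_szSector_eq_of_eigen`, `exists_fermiSet`, `sum_fermiSet_le`.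
-/

noncomputable section

namespace Summit.HubbardSuperconductivity.HubbardSuperconductivity.Theorems.WidthHaldane

set_option linter.dupNamespace false -- summit = problem name (single-conjunct summit), D-0017

open scoped BigOperators Classical Matrix ComplexConjugate
open Matrix Finset Literature.MathematicalPhysics.QuantumLattice



/-! ### `ℤ/2` bookkeeping -/

/-- In `ℤ/L × ℤ/2` the two transverse steps coincide: `p - e₂ = p + e₂`. [folklore] -/
theorem sub_e2_eq_add_e2 {L : ℕ} (p : ZMod L × ZMod 2) : p - (0, 1) = p + (0, 1) := by
  ext
  · simp
  · simp only [Prod.snd_sub, Prod.snd_add]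
    have h : (-1 : ZMod 2) = 1 := by decide
    rw [sub_eq_add_neg, h]

/-- The standard character of `ℤ/2` is the sign `(-1)^c`. [folklore] -/
theorem stdAddChar_zmod_two (c : ZMod 2) : (ZMod.stdAddChar c : ℂ) = (-1) ^ c.val := by
  rw [stdAddChar_eq_exp]
  have h : (2 * Real.pi * Complex.I * (c.val : ℂ) / (2 : ℕ)) = (c.val : ℂ) * (Real.pi * Complex.I) := by
    push_cast; ring
  rw [h, Complex.exp_nat_mul, Complex.exp_pi_mul_I]

/-- `2cos(2π c/2) = 2(-1)^c` for `c ∈ ℤ/2` (the `M = 2` value of the transverse term of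
`tubeTwistedBand`). [folklore] -/
theorem two_cos_two_pi_zmod_two (c : ZMod 2) :
    2 * Real.cos (2 * Real.pi * (c.val : ℝ) / (2 : ℕ)) = 2 * (-1) ^ c.val := by
  have h : 2 * Real.pi * (c.val : ℝ) / (2 : ℕ) = (c.val : ℝ) * Real.pi := by push_cast; ring
  rw [h, Real.cos_nat_mul_pi]

/-- The ladder band is the `M = 2` rectangular band corrected by the double-counted rung:
`ε^θ_{L,2}(a,b) = tubeTwistedBand L 2 θ (a,b) + (-1)^b`. [folklore] -/
theorem ladderTwistedBand_eq {L : ℕ} (θ : ℝ) (k : ZMod L × ZMod 2) :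
    ladderTwistedBand L θ k = tubeTwistedBand L 2 θ k + (-1) ^ k.2.val := by
  rw [ladderTwistedBand, tubeTwistedBand, two_cos_two_pi_zmod_two]
  ring

/-! ### The neighbour stencil of the labelled ladder -/

section Stencil

variable {L : ℕ} [NeZero L] {Λ : Type} [LinearOrder Λ] [Fintype Λ] (e : Λ ≃ ZMod L × ZMod 2)

/-- **The neighbour sum of the ladder.** For `L ≥ 3` the three neighbours `e⁻¹(e x ± e₁)`, `e⁻¹(e x + e₂)`
of `x` in the `M = 2` tube graph are pairwise distinct (the rung partner `e x + e₂ = e x - e₂` is ONE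
site), so `Σ_y [x ∼ y] f(y)` is the sum of `f` over them. [folklore] -/
theorem sum_adj_tubeGraph_two (hL : 3 ≤ L) {β : Type*} [AddCommMonoid β] (f : Λ → β) (x : Λ) :
    ∑ y, (if (tubeGraph e).Adj x y then f y else 0) =
      f (e.symm (e x + (1, 0))) + f (e.symm (e x - (1, 0))) + f (e.symm (e x + (0, 1))) := by
  haveI : Fact (1 < L) := ⟨by omega⟩
  have h2L := two_ne_zero_zmod L hL
  set p₁ : ZMod L × ZMod 2 := e x + (1, 0) with hp₁
  set p₂ : ZMod L × ZMod 2 := e x + (0, 1) with hp₂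
  set p₃ : ZMod L × ZMod 2 := e x - (1, 0) with hp₃
  have hp₄ : e x - (0, 1) = p₂ := by rw [hp₂, sub_e2_eq_add_e2]
  have h12 : p₁ ≠ p₂ := by
    rw [hp₁, hp₂, Ne, add_right_inj]; intro h; exact one_ne_zero (congrArg Prod.fst h)
  have h13 : p₁ ≠ p₃ := by
    rw [hp₁, hp₃, sub_eq_add_neg, Ne, add_right_inj]; intro h
    have h' : (1 : ZMod L) = -1 := congrArg Prod.fst h
    exact h2L (by linear_combination h')
  have h23 : p₂ ≠ p₃ := by
    rw [hp₂, hp₃, sub_eq_add_neg, Ne, add_right_inj]; intro h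
    have h' : (0 : ZMod L) = -1 := congrArg Prod.fst h
    exact one_ne_zero (neg_eq_zero.1 h'.symm)
  have h1x : p₁ ≠ e x := by rw [hp₁, Ne, add_eq_left]; intro h; exact one_ne_zero (congrArg Prod.fst h)
  have h2x : p₂ ≠ e x := by rw [hp₂, Ne, add_eq_left]; intro h; exact one_ne_zero (congrArg Prod.snd h)
  have h3x : p₃ ≠ e x := by
    rw [hp₃, Ne, sub_eq_self]; intro h; exact one_ne_zero (congrArg Prod.fst h)
  have hiff : ∀ p : ZMod L × ZMod 2, (x ≠ e.symm p ∧ (p = p₁ ∨ p = p₂ ∨ p = p₃ ∨ p = e x - (0, 1))) ↔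
      p ∈ ({p₁, p₂, p₃} : Finset (ZMod L × ZMod 2)) := by
    intro p
    rw [hp₄]
    simp only [mem_insert, mem_singleton]
    refine ⟨fun h => ?_, fun h => ⟨?_, ?_⟩⟩
    · rcases h.2 with h' | h' | h' | h'
      · exact Or.inl h'
      · exact Or.inr (Or.inl h')
      · exact Or.inr (Or.inr h')
      · exact Or.inr (Or.inl h')
    · intro hx
      have hp : p = e x := by rw [hx, Equiv.apply_symm_apply]
      rcases h with rfl | rfl | rfl
      · exact h1x hp
      · exact h2x hp
      · exact h3x hp
    · rcases h with h' | h' | h'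
      · exact Or.inl h'
      · exact Or.inr (Or.inl h')
      · exact Or.inr (Or.inr (Or.inl h'))
  calc ∑ y, (if (tubeGraph e).Adj x y then f y else 0)
      = ∑ p : ZMod L × ZMod 2, (if p ∈ ({p₁, p₂, p₃} : Finset (ZMod L × ZMod 2)) then f (e.symm p) else 0) := by
        rw [← Equiv.sum_comp e.symm]
        refine Finset.sum_congr rfl fun p _ => ?_
        have hc : (tubeGraph e).Adj x (e.symm p) ↔ p ∈ ({p₁, p₂, p₃} : Finset (ZMod L × ZMod 2)) := by
          rw [tubeGraph_adj_iff, Equiv.apply_symm_apply]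
          exact hiff p
        exact if_congr hc rfl rfl
    _ = ∑ p ∈ ({p₁, p₂, p₃} : Finset (ZMod L × ZMod 2)), f (e.symm p) := by
        rw [← Finset.sum_filter, Finset.filter_mem_eq_inter, Finset.univ_inter]
    _ = f (e.symm p₁) + f (e.symm p₃) + f (e.symm p₂) := by
        rw [sum_insert, sum_insert, sum_singleton, add_comm (f (e.symm p₂)) (f (e.symm p₃)), ← add_assoc]
        · simpa using h23
        · simp only [mem_insert, mem_singleton, not_or]; exact ⟨h12, h13⟩
    _ = f (e.symm (e x + (1, 0))) + f (e.symm (e x - (1, 0))) + f (e.symm (e x + (0, 1))) := by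
        rfl

end Stencil

/-! ### The twisted plane waves diagonalise the twisted hopping matrix of the ladder -/

section LadderEigen

variable {L : ℕ} [NeZero L] {Λ : Type} [LinearOrder Λ] [Fintype Λ] (e : Λ ≃ ZMod L × ZMod 2)

omit [NeZero L] in
/-- One transverse step multiplies the twisted wave by the sign `(-1)^b` of its transverse momentum.
[folklore] -/
theorem twistedWave_add_e2 (θ : ℝ) (k p : ZMod L × ZMod 2) :
    Complex.exp (Complex.I * (((2 * Real.pi * (k.1.val : ℝ) - θ) * ((p + (0, 1)).1.val : ℝ) / L : ℝ) : ℂ)) *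
        (ZMod.stdAddChar (k.2 * (p + (0, 1)).2) : ℂ) =
      Complex.exp (Complex.I * (((2 * Real.pi * (k.1.val : ℝ) - θ) * (p.1.val : ℝ) / L : ℝ) : ℂ)) *
        (ZMod.stdAddChar (k.2 * p.2) : ℂ) * (-1) ^ k.2.val := by
  simp only [Prod.fst_add, Prod.snd_add, add_zero]
  rw [mul_add, mul_one, AddChar.map_add_eq_mul, stdAddChar_zmod_two k.2]
  ring

/-- **The ladder stencil.** With the seam indicators of `h + T_θ` as coefficients, the THREE neighbour
values of the twisted wave `w^θ_k` (two along the legs, one across the rung) sum to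
`-ε^θ_{L,2}(k) w^θ_k(p)`, `ε^θ_{L,2} = ladderTwistedBand` (the four-term rectangular stencil
`twistedWave_stencil` at `M = 2`, minus the double-counted rung). [folklore] -/
theorem ladder_twistedWave_stencil (hL : 3 ≤ L) (θ : ℝ) (k p : ZMod L × ZMod 2) :
    (if p.1 = -1 then Complex.exp (-(Complex.I * θ)) else 1) *
          (Complex.exp (Complex.I * (((2 * Real.pi * (k.1.val : ℝ) - θ) * ((p + (1, 0)).1.val : ℝ) / L : ℝ) : ℂ)) *
            (ZMod.stdAddChar (k.2 * (p + (1, 0)).2) : ℂ)) +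
        (if p.1 = 0 then Complex.exp (Complex.I * θ) else 1) *
          (Complex.exp (Complex.I * (((2 * Real.pi * (k.1.val : ℝ) - θ) * ((p - (1, 0)).1.val : ℝ) / L : ℝ) : ℂ)) *
            (ZMod.stdAddChar (k.2 * (p - (1, 0)).2) : ℂ)) +
        Complex.exp (Complex.I * (((2 * Real.pi * (k.1.val : ℝ) - θ) * ((p + (0, 1)).1.val : ℝ) / L : ℝ) : ℂ)) *
          (ZMod.stdAddChar (k.2 * (p + (0, 1)).2) : ℂ) =
      Complex.exp (Complex.I * (((2 * Real.pi * (k.1.val : ℝ) - θ) * (p.1.val : ℝ) / L : ℝ) : ℂ)) *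
        (ZMod.stdAddChar (k.2 * p.2) : ℂ) * ((-(ladderTwistedBand L θ k) : ℝ) : ℂ) := by
  have h4 := twistedWave_stencil (M := 2) hL θ k p
  rw [sub_e2_eq_add_e2 p, twistedWave_add_e2 θ k p] at h4
  rw [twistedWave_add_e2 θ k p, ladderTwistedBand_eq]
  push_cast at h4 ⊢
  linear_combination h4

/-- **The twisted plane waves diagonalise the twisted hopping matrix of the ladder** (`L ≥ 3`, `M = 2`):
`(h + T_θ) V^θ = V^θ diag(ε^θ_{L,2} ∘ e ∘ site)`, `h = hubbardOneBody (tubeGraph e) 1 0`, `T_θ` the seam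
correction of `tubeTwist_eq_dGamma`, `V^θ` the twisted mode matrix of `WidthHaldaneTubeTwistedPlaneWaves`
(its orthonormality `conjTranspose_twistedPlaneWaves_mul_self` holds at every width). [folklore] -/
theorem twistedOneBody_mul_twistedPlaneWaves_ladder (hL : 3 ≤ L) (θ : ℝ) :
    (hubbardOneBody (tubeGraph e) 1 0 + Matrix.of fun o o' : Orb Λ =>
      if (ofLex o).2 = (ofLex o').2 then
        ((if (e (ofLex o).1).1 = 0 ∧ (ofLex o').1 = e.symm (-1, (e (ofLex o).1).2) then
            (1 - Complex.exp (Complex.I * θ)) else 0) +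
          (if (e (ofLex o').1).1 = 0 ∧ (ofLex o).1 = e.symm (-1, (e (ofLex o').1).2) then
            (1 - Complex.exp (-(Complex.I * θ))) else 0))
      else 0) *
        (Matrix.of fun o o' : Orb Λ => if (ofLex o).2 = (ofLex o').2 then
        (((Real.sqrt ((L : ℝ) * (2 : ℕ)))⁻¹ : ℝ) : ℂ) *
          (Complex.exp (Complex.I * (((2 * Real.pi * ((e (ofLex o').1).1.val : ℝ) - θ) *
              ((e (ofLex o).1).1.val : ℝ) / L : ℝ) : ℂ)) *
            (ZMod.stdAddChar ((e (ofLex o').1).2 * (e (ofLex o).1).2) : ℂ)) else 0) =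
      (Matrix.of fun o o' : Orb Λ => if (ofLex o).2 = (ofLex o').2 then
        (((Real.sqrt ((L : ℝ) * (2 : ℕ)))⁻¹ : ℝ) : ℂ) *
          (Complex.exp (Complex.I * (((2 * Real.pi * ((e (ofLex o').1).1.val : ℝ) - θ) *
              ((e (ofLex o).1).1.val : ℝ) / L : ℝ) : ℂ)) *
            (ZMod.stdAddChar ((e (ofLex o').1).2 * (e (ofLex o).1).2) : ℂ)) else 0) *
        diagonal fun o => ((ladderTwistedBand L θ (e (ofLex o).1) : ℝ) : ℂ) := by
  set T : Matrix (Orb Λ) (Orb Λ) ℂ := Matrix.of fun o o' : Orb Λ =>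
      if (ofLex o).2 = (ofLex o').2 then
        ((if (e (ofLex o).1).1 = 0 ∧ (ofLex o').1 = e.symm (-1, (e (ofLex o).1).2) then
            (1 - Complex.exp (Complex.I * θ)) else 0) +
          (if (e (ofLex o').1).1 = 0 ∧ (ofLex o).1 = e.symm (-1, (e (ofLex o').1).2) then
            (1 - Complex.exp (-(Complex.I * θ))) else 0))
      else 0 with hT
  have T_apply : ∀ (x : Λ) (σ : Fin 2) (y : Λ) (τ : Fin 2), T (orb x σ) (orb y τ) =
      if σ = τ then
        ((if (e x).1 = 0 ∧ y = e.symm (-1, (e x).2) then (1 - Complex.exp (Complex.I * θ)) else 0) +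
          (if (e y).1 = 0 ∧ x = e.symm (-1, (e y).2) then (1 - Complex.exp (-(Complex.I * θ))) else 0))
      else 0 := fun _ _ _ _ => rfl
  set W : Λ → (ZMod L × ZMod 2) → ℂ := fun z q =>
    Complex.exp (Complex.I * (((2 * Real.pi * ((e z).1.val : ℝ) - θ) * (q.1.val : ℝ) / L : ℝ) : ℂ)) *
      (ZMod.stdAddChar ((e z).2 * q.2) : ℂ) with hW
  set w : ℂ := (((Real.sqrt ((L : ℝ) * (2 : ℕ)))⁻¹ : ℝ) : ℂ) with hw
  set V : Matrix (Orb Λ) (Orb Λ) ℂ := (Matrix.of fun o o' : Orb Λ => if (ofLex o).2 = (ofLex o').2 then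
        (((Real.sqrt ((L : ℝ) * (2 : ℕ)))⁻¹ : ℝ) : ℂ) *
          (Complex.exp (Complex.I * (((2 * Real.pi * ((e (ofLex o').1).1.val : ℝ) - θ) *
              ((e (ofLex o).1).1.val : ℝ) / L : ℝ) : ℂ)) *
            (ZMod.stdAddChar ((e (ofLex o').1).2 * (e (ofLex o).1).2) : ℂ)) else 0) with hV
  have V_apply : ∀ (y : Λ) (σ : Fin 2) (z : Λ) (τ : Fin 2),
      V (orb y σ) (orb z τ) = if σ = τ then w * W z (e y) else 0 := by
    intro y σ z τ
    simp only [hV, Matrix.of_apply, orb, ofLex_toLex, hW, hw, mul_assoc]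
  ext o o'
  obtain ⟨x, σ⟩ := o
  obtain ⟨z, τ⟩ := o'
  change ((hubbardOneBody (tubeGraph e) 1 0 + T) * V) (orb x σ) (orb z τ) =
    (V * diagonal fun o : Orb Λ => ((ladderTwistedBand L θ (e (ofLex o).1) : ℝ) : ℂ)) (orb x σ) (orb z τ)
  rw [mul_diagonal, Matrix.mul_apply, sum_orb_eq_sum_sum, V_apply]
  simp only [Matrix.add_apply, hubbardOneBody_apply, T_apply, V_apply, orb, ofLex_toLex, Complex.ofReal_zero,
    Complex.ofReal_one, ite_self, sub_zero]
  have hsum : ∀ y : Λ, (∑ σ'' : Fin 2,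
      ((if (tubeGraph e).Adj x y ∧ σ = σ'' then (-1 : ℂ) else 0) +
          (if σ = σ'' then
            ((if (e x).1 = 0 ∧ y = e.symm (-1, (e x).2) then (1 - Complex.exp (Complex.I * θ)) else 0) +
              (if (e y).1 = 0 ∧ x = e.symm (-1, (e y).2) then (1 - Complex.exp (-(Complex.I * θ))) else 0))
          else 0)) * (if σ'' = τ then w * W z (e y) else 0)) =
      if σ = τ then
        ((if (tubeGraph e).Adj x y then -(w * W z (e y)) else 0) +
          (if (e x).1 = 0 ∧ y = e.symm (-1, (e x).2) then (1 - Complex.exp (Complex.I * θ)) * (w * W z (e y)) else 0) +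
          (if (e y).1 = 0 ∧ x = e.symm (-1, (e y).2) then (1 - Complex.exp (-(Complex.I * θ))) * (w * W z (e y)) else 0))
      else 0 := by
    intro y
    rw [Finset.sum_eq_single σ]
    · by_cases hστ : σ = τ
      · simp only [hστ, and_true, if_true]
        split_ifs <;> ring
      · simp only [hστ, if_false, mul_zero]
    · intro σ'' _ hσ
      rw [if_neg (fun h => hσ h.2.symm), if_neg (Ne.symm hσ), zero_add, zero_mul]
    · intro h; exact absurd (mem_univ _) h
  simp_rw [hsum]
  by_cases hστ : σ = τ
  · simp_rw [if_pos hστ]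
    rw [Finset.sum_add_distrib, Finset.sum_add_distrib, sum_adj_tubeGraph_two e hL,
      sum_seam_A e (fun y => (1 - Complex.exp (Complex.I * θ)) * (w * W z (e y))) x,
      sum_seam_B e (fun y => (1 - Complex.exp (-(Complex.I * θ))) * (w * W z (e y))) x]
    simp only [Equiv.apply_symm_apply]
    have hA : (if (e x).1 = 0 then (1 - Complex.exp (Complex.I * θ)) * (w * W z (-1, (e x).2)) else 0) =
        (if (e x).1 = 0 then (1 - Complex.exp (Complex.I * θ)) else 0) * (w * W z (e x - (1, 0))) := by
      by_cases h0 : (e x).1 = 0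
      · rw [if_pos h0, if_pos h0]
        congr 3
        ext <;> simp [h0]
      · rw [if_neg h0, if_neg h0, zero_mul]
    have hB : (if (e x).1 = -1 then (1 - Complex.exp (-(Complex.I * θ))) * (w * W z (0, (e x).2)) else 0) =
        (if (e x).1 = -1 then (1 - Complex.exp (-(Complex.I * θ))) else 0) * (w * W z (e x + (1, 0))) := by
      by_cases h1 : (e x).1 = -1
      · rw [if_pos h1, if_pos h1]
        congr 3
        ext <;> simp [h1]
      · rw [if_neg h1, if_neg h1, zero_mul]
    rw [hA, hB]
    have hst := ladder_twistedWave_stencil hL θ (e z) (e x)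
    simp only [hW] at hst ⊢
    have c1 : (if (e x).1 = -1 then (1 - Complex.exp (-(Complex.I * θ))) else (0 : ℂ)) =
        1 - (if (e x).1 = -1 then Complex.exp (-(Complex.I * θ)) else 1) := by split_ifs <;> ring
    have c2 : (if (e x).1 = 0 then (1 - Complex.exp (Complex.I * θ)) else (0 : ℂ)) =
        1 - (if (e x).1 = 0 then Complex.exp (Complex.I * θ) else 1) := by split_ifs <;> ring
    rw [c1, c2]
    push_cast at hst ⊢
    linear_combination (-w) * hst
  · simp_rw [if_neg hστ]
    rw [Finset.sum_const_zero, zero_mul]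

/-! ### The free floor of the labelled ladder -/

/-- **The free floor of the TWISTED two-leg ladder.** For `L ≥ 3`, every linearly ordered carrier
`e : Λ ≃ ℤ/L × ℤ/2` and every Fermi set `F` of the twisted ladder band `ε^θ_{L,2}` (`≤ μ` on `F`,
`μ ≤` off `F`): `tubeEnergy L 2 Λ e 0 θ (2 #F) = 2 Σ_{k∈F} ladderTwistedBand L θ k` — the exact
`U = 0` value of the twisted sector energies of the cruxes' `M = 2` tube (the isotropic Hubbard
ladder), entering `tubeStiffness L 2` at `θ = 0` and `θ = π/3`. Byers–Yang (1961); BCS (1957) §II.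
[folklore] -/
theorem tubeEnergy_free_ladder_eq (hL : 3 ≤ L) (θ : ℝ) (F : Finset (ZMod L × ZMod 2)) (μ : ℝ)
    (hF : ∀ k ∈ F, ladderTwistedBand L θ k ≤ μ) (hF' : ∀ k ∉ F, μ ≤ ladderTwistedBand L θ k) :
    tubeEnergy L 2 Λ e 0 θ (2 * F.card) = 2 * ∑ k ∈ F, ladderTwistedBand L θ k := by
  set F' : Finset Λ := F.map e.symm.toEmbedding with hF'def
  have hcard : F'.card = F.card := Finset.card_map _
  have hmem : ∀ x : Λ, x ∈ F' ↔ e x ∈ F := fun x => by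
    rw [hF'def, Finset.mem_map_equiv]
    simp
  have hsumF : ∑ x ∈ F', ladderTwistedBand L θ (e x) = ∑ k ∈ F, ladderTwistedBand L θ k := by
    rw [hF'def, Finset.sum_map]
    simp
  rw [tubeEnergy_eq, tubeH0_zero_eq_dGamma, tubeTwist_eq_dGamma, ← dGamma_add, ← hcard, ← hsumF]
  exact minEnergyOn_dGamma_szSector_eq_of_eigen _ _
    (conjTranspose_twistedPlaneWaves_mul_self e θ) (fun o o' h => by rw [Matrix.of_apply, if_neg h])
    (fun x => ladderTwistedBand L θ (e x)) (twistedOneBody_mul_twistedPlaneWaves_ladder e hL θ) F' μ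
    (fun x hx => hF (e x) ((hmem x).1 hx)) (fun x hx => hF' (e x) (fun h => hx ((hmem x).2 h)))

/-- **Variational form**: at `U = 0` the twisted sector energy of `2 #T` electrons on the ladder is at
most the paired energy of ANY momentum set `T`. [folklore] -/
theorem tubeEnergy_free_ladder_le (hL : 3 ≤ L) (θ : ℝ) (T : Finset (ZMod L × ZMod 2)) :
    tubeEnergy L 2 Λ e 0 θ (2 * T.card) ≤ 2 * ∑ k ∈ T, ladderTwistedBand L θ k := by
  obtain ⟨F, μ, hc, hF, hF'⟩ := exists_fermiSet (ladderTwistedBand L θ) (n := T.card)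
    (by rw [← Finset.card_univ]; exact Finset.card_le_card (Finset.subset_univ T))
  rw [← hc, tubeEnergy_free_ladder_eq e hL θ F μ hF hF']
  have h := sum_fermiSet_le (ladderTwistedBand L θ) (fun k => if k ∈ T then (1 : ℝ) else 0) F μ hF hF'
    (fun k => by positivity) (fun k => by split_ifs <;> norm_num)
    (by rw [Finset.sum_boole, Finset.filter_mem_eq_inter, Finset.univ_inter, hc])
  simp only [mul_ite, mul_one, mul_zero, Finset.sum_ite_mem, Finset.univ_inter] at h
  linarith

/-- **Existence form**: for every pair number `n ≤ 2L` the twisted `U = 0` sector energy of the ladder IS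
the paired energy of a Fermi set of the twisted ladder band. [folklore] -/
theorem exists_fermiSet_tubeEnergy_free_ladder_eq (hL : 3 ≤ L) (θ : ℝ) {n : ℕ} (hn : n ≤ L * 2) :
    ∃ (F : Finset (ZMod L × ZMod 2)) (μ : ℝ), F.card = n ∧ (∀ k ∈ F, ladderTwistedBand L θ k ≤ μ) ∧
      (∀ k ∉ F, μ ≤ ladderTwistedBand L θ k) ∧
      tubeEnergy L 2 Λ e 0 θ (2 * n) = 2 * ∑ k ∈ F, ladderTwistedBand L θ k := by
  obtain ⟨F, μ, hc, hF, hF'⟩ := exists_fermiSet (ladderTwistedBand L θ) (n := n)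
    (by rw [Fintype.card_prod, ZMod.card, ZMod.card]; exact hn)
  exact ⟨F, μ, hc, hF, hF', by rw [← hc, tubeEnergy_free_ladder_eq e hL θ F μ hF hF']⟩

/-- **Same-Fermi-set comparison.** For every Fermi set `F` of the UNTWISTED ladder band (θ = 0) the
twisted energy is at most the twisted band sum over the same set, while the untwisted energy equals
its band sum: `E(θ, 2#F) - E(0, 2#F) ≤ 2 Σ_{k∈F} (ε^θ_{L,2}(k) - ε^0_{L,2}(k))` — the free
paramagnetic/diamagnetic test that decides the sign of `tubeStiffness L 2 … 0 δ`. [folklore] -/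
theorem tubeEnergy_free_ladder_sub_le (hL : 3 ≤ L) (θ : ℝ) (F : Finset (ZMod L × ZMod 2)) (μ : ℝ)
    (hF : ∀ k ∈ F, ladderTwistedBand L 0 k ≤ μ) (hF' : ∀ k ∉ F, μ ≤ ladderTwistedBand L 0 k) :
    tubeEnergy L 2 Λ e 0 θ (2 * F.card) - tubeEnergy L 2 Λ e 0 0 (2 * F.card) ≤
      2 * ∑ k ∈ F, (ladderTwistedBand L θ k - ladderTwistedBand L 0 k) := by
  rw [tubeEnergy_free_ladder_eq e hL 0 F μ hF hF', Finset.sum_sub_distrib, mul_sub]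
  linarith [tubeEnergy_free_ladder_le e hL θ F]

end LadderEigen

end Summit.HubbardSuperconductivity.HubbardSuperconductivity.Theorems.WidthHaldane

end
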